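/-
Copyright (c) 2026 the pub-hodgecm-mathlib formalisation cell (harness21).  Prover seat hodgecm-mathlib-K2E3-p03 (g6), Track B «K2-LIT» ∕ h413
(`stmt-HodgeConjecture-24833`), line `K2_E3_EllipticInputs`, road (11-3-split-nsc), leaf (nsc-S-A′) `sig_K2E3GL3PrincipalBlockStandardSpan` (owner K2E3-p25 (g0)),
line «IH-x×x×x» (lead K2E3-p03 (g6) by D78; dealer K2E3-plan (g4)), brick IH-2d: EVERY `G`-ENDOMORPHISM OF `1 × 1 × 1` IS A SCALAR ON THE IWAHORI-FIXED VECTORS.  2026-09-04.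
-/
import Summits.HodgeConjecture.HodgeConjecture.Theorems.K2E3GL3IwahoriHeckeMatrices     -- ★ IH-2c (this seat): entries + tables; brings ★ IH-2b, IH-2a, IH-1, ★ IH-4
import HarnessLib

/-!
# K2_E3 road (h413), leaf (nsc-S-A′), line «IH-x×x×x», brick IH-2d: for `I = 1 × 1 × 1 = Ind_B^{GL₃(F)} δ_B^{1∕2}`, every intertwining operator `Φ : I → I` acts on
# `I^{Iw}` by a SCALAR — the matrix of `Φ|_{I^{Iw}}` commutes with the Iwahori–Hecke matrices `T₁, T₂, P` (★ IH-2c) whose commutant is `ℂ·1` (★ IH-4)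

Cell `pub/hodgecm-mathlib` (D-0151), Track B, seat K2E3-p03 (g6), LEAD of line «IH-x×x×x» (dealer D78); architect K2E3-p25.  `--supports stmt-HodgeConjecture-24833 --as helper`;
THEOREMS ONLY (no definition ∕ instance ∕ notation ∕ named fact ∕ `sorry`); never imports `Cruxes/…/Lines`.  COUNT-NEUTRAL helper.

THE MATHEMATICS [IwahoriMatsumoto1965, §3]; [Borel1976, §3–§4 (the functor `V ↦ V^{Iw}` to `ℋ(G, Iw)`-modules)]; [Casselman1980, §3].  `I = parabolicIndGL F id (𝟙.twist 1)`,
`Iw = iwahoriGL 3 F`, `e = (Representation.parabolicIndGL F (id : Fin 3 → Fin 3) ((Representation.trivial ℂ (Π a : Fin 3, GL {i : Fin 3 // (id : Fin 3 → Fin 3) i = a} F) ℂ).twist 1)).avgProj Iw`, `q = |𝓀[F]|`, `r = P_{(0 1 2)} diag(ϖ, 1, 1)`, Iwahori basis `φ_σ` (★ IH-1 `exists_iwahoriBasisFun`, `χ = 1` is unramified),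
`ι = ![1, (1 2), (0 1), (0 1 2), (0 2 1), (0 2)]` (p11's lexicographic order).  For an intertwining `Φ` put `X_{ab} = (Φ φ_{ι b})(P_{ι a})`, `(T₁)_{ab} = (q·e π(P_{(0 1)}) φ_{ι b})(P_{ι a})`,
`T₂` likewise with `(1 2)`, `P_{ab} = (π(r⁻¹) φ_{ι b})(P_{ι a})`.  Since `Φ` commutes with `π(g)` and with `e` (★ IH-2b `apply_avgProj_eq_avgProj_apply`), and all four operators preserve
`I^{Iw}` (★ IH-2b∕2c), the matrices multiply (★ IH-2b `toFun_apply_apply_eq_sum_mul`, reindexed along the bijection `ι`) and `X T₁ = T₁ X`, `X T₂ = T₂ X`, `X P = P X`; by ★ IH-2c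
the three are p11's LITERALS, so ★ IH-4 `eq_smul_one_of_commute` (`q ≠ 0, 1`) gives `X = X₀₀·1`, i.e. `Φ φ_σ = c φ_σ` (★ IH-1 (M2)), i.e. **`Φ f = c • f` on `I^{Iw}`**
(`exists_smul_of_intertwiningMap`) — the half of `End_G(I) = ℂ` that IH-5 combines with IH-3 («a subrepresentation of `I` without `Iw`-fixed vectors is `0`») and
unitarity ★ `isSemisimpleRepresentation_parabolicIndGL_twist` to conclude that `1 × 1 × 1` is irreducible.
HONEST LABEL: HC_CM is proved only modulo the 7 printed citations (2 remaining named inputs: hLiu418 = stmt-HodgeConjecture-24832, h413 = stmt-HodgeConjecture-24833)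
until rung 0 closes; count-neutral helper (no printed citation is discharged).

## Mathlib ∕ tree search
Tree ★: IH-2c `entry_hecke_swap`∕`entry_R`∕`normAbs_dInv_apply`∕`table_T₁∕T₂∕P`∕`apply_rInv_mem_fixedPoints`, IH-2b `apply_avgProj_eq_avgProj_apply`∕`avgProj_apply_mem_fixedPoints`∕
`toFun_apply_apply_eq_sum_mul`∕`eq_sum_toFun_smul_basis`, IH-1 `exists_iwahoriBasisFun`∕`eq_of_forall_toFun_permGL_eq`, IH-4 `eq_smul_one_of_commute`, `exists_isUniformizer` (LocalExistenceLubinTate),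
`avgProjLinear` (CompactOpenAveraging).  Mathlib: `Representation.IntertwiningMap.isIntertwining`, `Equiv.ofBijective`, `Equiv.sum_comp`, `Finite.one_lt_card`.
Dedup: `rg "exists_smul_of_intertwiningMap|IwahoriEndomorphism"` over `Literature Summits` — no hits.

## References
* [IwahoriMatsumoto1965] N. Iwahori, H. Matsumoto, Publ. Math. IHÉS 25 (1965), §3.  * [Borel1976] A. Borel, Invent. Math. 35 (1976), §3–§4.
* [Casselman1980] W. Casselman, Compositio Math. 40 (1980), §3.  * [CartierCorvallis1979] P. Cartier, PSPM 33.1 (1979), §IV.1.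
-/

set_option autoImplicit false
-- the mandated namespace repeats the single-problem summit's segment (`HodgeConjecture.HodgeConjecture`)
set_option linter.dupNamespace false

noncomputable section

open Matrix
open scoped MatrixGroups NNReal
open Literature.NumberTheory.Automorphic ValuativeRel
open Literature.NumberTheory.GaloisRepresentations Literature.NumberTheory.GaloisRepresentations.IsNonarchimedeanLocalField
open Summit.HodgeConjecture.HodgeConjecture.Cruxes.H413

namespace Summit.HodgeConjecture.HodgeConjecture.Cruxes.H413.K2E3GL3IwahoriEndomorphismScalar

variable {F : Type} [Field F] [ValuativeRel F] [TopologicalSpace F] [IsNonarchimedeanLocalField F]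

/-- `q = |𝓀[F]| ≠ 0, 1` in `ℂ`. [folklore] -/
theorem card_residueField_ne_zero_and_ne_one : (Nat.card 𝓀[F] : ℂ) ≠ 0 ∧ (Nat.card 𝓀[F] : ℂ) ≠ 1 := by
  have h1 : 1 < Nat.card 𝓀[F] := Finite.one_lt_card
  exact ⟨Nat.cast_ne_zero.2 (by omega), fun h => by have := (Nat.cast_eq_one.1 h); omega⟩

/-- Cast bookkeeping for the `P`-table: `ℝ≥0 → ℝ → ℂ` of `(n or 1)·(n or 1)⁻¹`. [folklore] -/
theorem cast_ite_mul_ite_inv (p p' : Prop) [Decidable p] [Decidable p'] (n : ℕ) :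
    ((((if p then (n : ℝ≥0) else 1) * (if p' then (n : ℝ≥0) else 1)⁻¹ : ℝ≥0) : ℝ) : ℂ) =
      (if p then (n : ℂ) else 1) * (if p' then (n : ℂ) else 1)⁻¹ := by
  split_ifs <;> push_cast <;> ring

set_option maxHeartbeats 800000 in
-- one long assembly (three 6×6 matrix identities over the induced module); the per-command budget is cumulative
/-- **`End_G(1 × 1 × 1)` ACTS BY SCALARS ON `I^{Iw}`**: for every intertwining operator `Φ` of `I = parabolicIndGL F id (𝟙.twist 1)` on `GL₃(F)` there is `c : ℂ` with `Φ f = c • f` for all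
`Iw`-fixed `f` (matrix of `Φ|_{I^{Iw}}` commutes with ★ IH-2c's `T₁, T₂, P`; ★ IH-4). [cite: IwahoriMatsumoto1965, §3] [cite: Borel1976, §3–§4] [cite: Casselman1980, §3] -/
theorem exists_smul_of_intertwiningMap
    (Φ : (Representation.parabolicIndGL F (id : Fin 3 → Fin 3)
        ((Representation.trivial ℂ (Π a : Fin 3, GL {i : Fin 3 // (id : Fin 3 → Fin 3) i = a} F) ℂ).twist 1)).IntertwiningMap
      (Representation.parabolicIndGL F (id : Fin 3 → Fin 3)
        ((Representation.trivial ℂ (Π a : Fin 3, GL {i : Fin 3 // (id : Fin 3 → Fin 3) i = a} F) ℂ).twist 1))) :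
    ∃ c : ℂ, ∀ f ∈ (Representation.parabolicIndGL F (id : Fin 3 → Fin 3)
        ((Representation.trivial ℂ (Π a : Fin 3, GL {i : Fin 3 // (id : Fin 3 → Fin 3) i = a} F) ℂ).twist 1)).fixedPoints (iwahoriGL 3 F),
      Φ f = c • f := by
  classical
  have hsm : (Representation.parabolicIndGL F (id : Fin 3 → Fin 3) ((Representation.trivial ℂ (Π a : Fin 3, GL {i : Fin 3 // (id : Fin 3 → Fin 3) i = a} F) ℂ).twist 1)).IsSmooth := Representation.isSmooth_smoothInd _ _
  have hK : IsCompact (iwahoriGL 3 F : Set (GL (Fin 3) F)) := isCompact_iwahoriGL 3 F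
  obtain ⟨hq0, hq1⟩ := card_residueField_ne_zero_and_ne_one (F := F)
  obtain ⟨ϖu, hϖ⟩ := exists_isUniformizer F
  -- the Iwahori basis (`χ = 1` is unramified)
  have hχ : ∀ p : ↥(standardParabolicGL F (id : Fin 3 → Fin 3)), (p : GL (Fin 3) F) ∈ glInt 3 F →
      (1 : (Π a : Fin 3, GL {i : Fin 3 // (id : Fin 3 → Fin 3) i = a} F) →* ℂˣ) (leviProjection F (id : Fin 3 → Fin 3) p) = 1 := fun _ _ => rfl
  choose φ hφ hφv _hφc using fun σ => K2E3GL3IwahoriBruhat.exists_iwahoriBasisFun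
    (1 : (Π a : Fin 3, GL {i : Fin 3 // (id : Fin 3 → Fin 3) i = a} F) →* ℂˣ) hχ σ
  -- the basis order `ι` and the matrices
  obtain ⟨ι, hι⟩ : ∃ ι : Fin 6 → Equiv.Perm (Fin 3), ι = ![1, Equiv.swap 1 2, Equiv.swap 0 1, finRotate 3, (finRotate 3)⁻¹, Equiv.swap 0 2] :=
    ⟨_, rfl⟩
  have hιb : Function.Bijective ι := by rw [hι]; decide
  obtain ⟨eι, heι⟩ : ∃ e : Fin 6 ≃ Equiv.Perm (Fin 3), ∀ c, e c = ι c := ⟨Equiv.ofBijective ι hιb, fun _ => rfl⟩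
  have hιe : ∀ τ, ι (eι.symm τ) = τ := fun τ => by rw [← heι, Equiv.apply_symm_apply]
  -- `Φ` preserves `I^{Iw}`
  have hΦ : ∀ σ, Φ (φ σ) ∈ (Representation.parabolicIndGL F (id : Fin 3 → Fin 3) ((Representation.trivial ℂ (Π a : Fin 3, GL {i : Fin 3 // (id : Fin 3 → Fin 3) i = a} F) ℂ).twist 1)).fixedPoints (iwahoriGL 3 F) := fun σ => by
    rw [Representation.mem_fixedPoints]
    intro k hk
    rw [← Φ.isIntertwining, (Representation.mem_fixedPoints _ _ _).1 (hφ σ) k hk]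
  -- the three operators as linear maps
  obtain ⟨B₁, hB₁⟩ : ∃ B : Representation.SmoothInd (standardParabolicGL F (id : Fin 3 → Fin 3)) (Representation.twist (((Representation.trivial ℂ (Π a : Fin 3, GL {i : Fin 3 // (id : Fin 3 → Fin 3) i = a} F) ℂ).twist 1).comp (leviProjection F (id : Fin 3 → Fin 3))) (rootDeltaChar (standardParabolicGL F (id : Fin 3 → Fin 3)))) →ₗ[ℂ]
      Representation.SmoothInd (standardParabolicGL F (id : Fin 3 → Fin 3)) (Representation.twist (((Representation.trivial ℂ (Π a : Fin 3, GL {i : Fin 3 // (id : Fin 3 → Fin 3) i = a} F) ℂ).twist 1).comp (leviProjection F (id : Fin 3 → Fin 3))) (rootDeltaChar (standardParabolicGL F (id : Fin 3 → Fin 3)))), B = (Nat.card 𝓀[F] : ℂ) • (((Representation.parabolicIndGL F (id : Fin 3 → Fin 3) ((Representation.trivial ℂ (Π a : Fin 3, GL {i : Fin 3 // (id : Fin 3 → Fin 3) i = a} F) ℂ).twist 1)).avgProjLinear (iwahoriGL 3 F) hsm hK) ∘ₗ ((Representation.parabolicIndGL F (id : Fin 3 → Fin 3) ((Representation.trivial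 ℂ (Π a : Fin 3, GL {i : Fin 3 // (id : Fin 3 → Fin 3) i = a} F) ℂ).twist 1)) (permGL (Equiv.swap 0 1)))) := ⟨_, rfl⟩
  obtain ⟨B₂, hB₂⟩ : ∃ B : Representation.SmoothInd (standardParabolicGL F (id : Fin 3 → Fin 3)) (Representation.twist (((Representation.trivial ℂ (Π a : Fin 3, GL {i : Fin 3 // (id : Fin 3 → Fin 3) i = a} F) ℂ).twist 1).comp (leviProjection F (id : Fin 3 → Fin 3))) (rootDeltaChar (standardParabolicGL F (id : Fin 3 → Fin 3)))) →ₗ[ℂ]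
      Representation.SmoothInd (standardParabolicGL F (id : Fin 3 → Fin 3)) (Representation.twist (((Representation.trivial ℂ (Π a : Fin 3, GL {i : Fin 3 // (id : Fin 3 → Fin 3) i = a} F) ℂ).twist 1).comp (leviProjection F (id : Fin 3 → Fin 3))) (rootDeltaChar (standardParabolicGL F (id : Fin 3 → Fin 3)))), B = (Nat.card 𝓀[F] : ℂ) • (((Representation.parabolicIndGL F (id : Fin 3 → Fin 3) ((Representation.trivial ℂ (Π a : Fin 3, GL {i : Fin 3 // (id : Fin 3 → Fin 3) i = a} F) ℂ).twist 1)).avgProjLinear (iwahoriGL 3 F) hsm hK) ∘ₗ ((Representation.parabolicIndGL F (id : Fin 3 → Fin 3) ((Representation.trivial ℂ (Π a : Fin 3, GL {i : Fin 3 // (id : Fin 3 → Fin 3) i = a} F) ℂ).twist 1)) (permGL (Equiv.swap 1 2)))) := ⟨_, rfl⟩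
  have hB₁v : ∀ v, B₁ v = (Nat.card 𝓀[F] : ℂ) • (Representation.parabolicIndGL F (id : Fin 3 → Fin 3) ((Representation.trivial ℂ (Π a : Fin 3, GL {i : Fin 3 // (id : Fin 3 → Fin 3) i = a} F) ℂ).twist 1)).avgProj (iwahoriGL 3 F) ((Representation.parabolicIndGL F (id : Fin 3 → Fin 3) ((Representation.trivial ℂ (Π a : Fin 3, GL {i : Fin 3 // (id : Fin 3 → Fin 3) i = a} F) ℂ).twist 1)) (permGL (Equiv.swap 0 1)) v) := fun v => by
    simp only [hB₁, LinearMap.smul_apply, LinearMap.coe_comp, Function.comp_apply, Representation.avgProjLinear_apply]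
  have hB₂v : ∀ v, B₂ v = (Nat.card 𝓀[F] : ℂ) • (Representation.parabolicIndGL F (id : Fin 3 → Fin 3) ((Representation.trivial ℂ (Π a : Fin 3, GL {i : Fin 3 // (id : Fin 3 → Fin 3) i = a} F) ℂ).twist 1)).avgProj (iwahoriGL 3 F) ((Representation.parabolicIndGL F (id : Fin 3 → Fin 3) ((Representation.trivial ℂ (Π a : Fin 3, GL {i : Fin 3 // (id : Fin 3 → Fin 3) i = a} F) ℂ).twist 1)) (permGL (Equiv.swap 1 2)) v) := fun v => by
    simp only [hB₂, LinearMap.smul_apply, LinearMap.coe_comp, Function.comp_apply, Representation.avgProjLinear_apply]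
  have hB₁fix : ∀ σ, B₁ (φ σ) ∈ (Representation.parabolicIndGL F (id : Fin 3 → Fin 3) ((Representation.trivial ℂ (Π a : Fin 3, GL {i : Fin 3 // (id : Fin 3 → Fin 3) i = a} F) ℂ).twist 1)).fixedPoints (iwahoriGL 3 F) := fun σ => by
    rw [hB₁v]; exact Submodule.smul_mem _ _ (K2E3GLnIwahoriHeckeOperators.avgProj_apply_mem_fixedPoints 1 _ _)
  have hB₂fix : ∀ σ, B₂ (φ σ) ∈ (Representation.parabolicIndGL F (id : Fin 3 → Fin 3) ((Representation.trivial ℂ (Π a : Fin 3, GL {i : Fin 3 // (id : Fin 3 → Fin 3) i = a} F) ℂ).twist 1)).fixedPoints (iwahoriGL 3 F) := fun σ => by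
    rw [hB₂v]; exact Submodule.smul_mem _ _ (K2E3GLnIwahoriHeckeOperators.avgProj_apply_mem_fixedPoints 1 _ _)
  have hRfix : ∀ σ, ((Representation.parabolicIndGL F (id : Fin 3 → Fin 3) ((Representation.trivial ℂ (Π a : Fin 3, GL {i : Fin 3 // (id : Fin 3 → Fin 3) i = a} F) ℂ).twist 1)) (permGL (finRotate 3) * diagonalGL (Fin 3) F ![Units.mk0 (ϖu : F) hϖ.ne_zero, 1, 1])⁻¹ : _ →ₗ[ℂ] _) (φ σ) ∈ (Representation.parabolicIndGL F (id : Fin 3 → Fin 3) ((Representation.trivial ℂ (Π a : Fin 3, GL {i : Fin 3 // (id : Fin 3 → Fin 3) i = a} F) ℂ).twist 1)).fixedPoints (iwahoriGL 3 F) := fun σ =>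
    K2E3GL3IwahoriHeckeMatrices.apply_rInv_mem_fixedPoints hϖ 1 (hφ σ)
  -- `Φ` commutes with them
  have hc₁ : ∀ v, Φ (B₁ v) = B₁ (Φ v) := fun v => by
    rw [hB₁v, hB₁v, map_smul, K2E3GLnIwahoriHeckeOperators.apply_avgProj_eq_avgProj_apply hK Φ (hsm _), Φ.isIntertwining]
  have hc₂ : ∀ v, Φ (B₂ v) = B₂ (Φ v) := fun v => by
    rw [hB₂v, hB₂v, map_smul, K2E3GLnIwahoriHeckeOperators.apply_avgProj_eq_avgProj_apply hK Φ (hsm _), Φ.isIntertwining]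
  have hcR : ∀ v, Φ (((Representation.parabolicIndGL F (id : Fin 3 → Fin 3) ((Representation.trivial ℂ (Π a : Fin 3, GL {i : Fin 3 // (id : Fin 3 → Fin 3) i = a} F) ℂ).twist 1)) (permGL (finRotate 3) * diagonalGL (Fin 3) F ![Units.mk0 (ϖu : F) hϖ.ne_zero, 1, 1])⁻¹ : _ →ₗ[ℂ] _) v) = ((Representation.parabolicIndGL F (id : Fin 3 → Fin 3) ((Representation.trivial ℂ (Π a : Fin 3, GL {i : Fin 3 // (id : Fin 3 → Fin 3) i = a} F) ℂ).twist 1)) (permGL (finRotate 3) * diagonalGL (Fin 3) F ![Units.mk0 (ϖu : F) hϖ.ne_zero, 1, 1])⁻¹ : _ →ₗ[ℂ] _) (Φ v) := fun v => by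
    rw [Φ.isIntertwining]
  -- matrices multiply: `(M_A * M_B)_{ab} = (A (B φ_{ι b}))(P_{ι a})`
  have hmul : ∀ (A B : Representation.SmoothInd (standardParabolicGL F (id : Fin 3 → Fin 3)) (Representation.twist (((Representation.trivial ℂ (Π a : Fin 3, GL {i : Fin 3 // (id : Fin 3 → Fin 3) i = a} F) ℂ).twist 1).comp (leviProjection F (id : Fin 3 → Fin 3))) (rootDeltaChar (standardParabolicGL F (id : Fin 3 → Fin 3)))) →ₗ[ℂ]
      Representation.SmoothInd (standardParabolicGL F (id : Fin 3 → Fin 3)) (Representation.twist (((Representation.trivial ℂ (Π a : Fin 3, GL {i : Fin 3 // (id : Fin 3 → Fin 3) i = a} F) ℂ).twist 1).comp (leviProjection F (id : Fin 3 → Fin 3))) (rootDeltaChar (standardParabolicGL F (id : Fin 3 → Fin 3))))), (∀ σ, B (φ σ) ∈ (Representation.parabolicIndGL F (id : Fin 3 → Fin 3) ((Representation.trivial ℂ (Π a : Fin 3, GL {i : Fin 3 // (id : Fin 3 → Fin 3) i = a} F) ℂ).twist 1)).fixedPoints (iwahoriGL 3 F)) → ∀ a b : Fin 6,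
      ((Matrix.of fun a b : Fin 6 => (A (φ (ι b))).toFun (permGL (ι a))) * (Matrix.of fun a b : Fin 6 => (B (φ (ι b))).toFun (permGL (ι a)))) a b =
        (A (B (φ (ι b)))).toFun (permGL (ι a)) := by
    intro A B hB a b
    rw [Matrix.mul_apply, K2E3GLnIwahoriHeckeOperators.toFun_apply_apply_eq_sum_mul 1 φ hφ hφv A B hB,
      ← eι.sum_comp (fun ρ => (A (φ ρ)).toFun (permGL (ι a)) * (B (φ (ι b))).toFun (permGL ρ))]
    simp only [Matrix.of_apply, heι]
  have hΦ' : ∀ σ, Φ.toLinearMap (φ σ) ∈ (Representation.parabolicIndGL F (id : Fin 3 → Fin 3)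
      ((Representation.trivial ℂ (Π a : Fin 3, GL {i : Fin 3 // (id : Fin 3 → Fin 3) i = a} F) ℂ).twist 1)).fixedPoints (iwahoriGL 3 F) := fun σ => by
    rw [Representation.IntertwiningMap.toLinearMap_apply]; exact hΦ σ
  have hX₁ : (Matrix.of fun a b : Fin 6 => (Φ.toLinearMap (φ (ι b))).toFun (permGL (ι a))) * (Matrix.of fun a b : Fin 6 => (B₁ (φ (ι b))).toFun (permGL (ι a))) =
      (Matrix.of fun a b : Fin 6 => (B₁ (φ (ι b))).toFun (permGL (ι a))) * (Matrix.of fun a b : Fin 6 => (Φ.toLinearMap (φ (ι b))).toFun (permGL (ι a))) := by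
    ext a b
    rw [hmul Φ.toLinearMap _ hB₁fix a b, hmul _ Φ.toLinearMap hΦ' a b, Representation.IntertwiningMap.toLinearMap_apply,
      Representation.IntertwiningMap.toLinearMap_apply, hc₁]
  have hX₂ : (Matrix.of fun a b : Fin 6 => (Φ.toLinearMap (φ (ι b))).toFun (permGL (ι a))) * (Matrix.of fun a b : Fin 6 => (B₂ (φ (ι b))).toFun (permGL (ι a))) =
      (Matrix.of fun a b : Fin 6 => (B₂ (φ (ι b))).toFun (permGL (ι a))) * (Matrix.of fun a b : Fin 6 => (Φ.toLinearMap (φ (ι b))).toFun (permGL (ι a))) := by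
    ext a b
    rw [hmul Φ.toLinearMap _ hB₂fix a b, hmul _ Φ.toLinearMap hΦ' a b, Representation.IntertwiningMap.toLinearMap_apply,
      Representation.IntertwiningMap.toLinearMap_apply, hc₂]
  have hXP : (Matrix.of fun a b : Fin 6 => (Φ.toLinearMap (φ (ι b))).toFun (permGL (ι a))) * (Matrix.of fun a b : Fin 6 => ((((Representation.parabolicIndGL F (id : Fin 3 → Fin 3) ((Representation.trivial ℂ (Π a : Fin 3, GL {i : Fin 3 // (id : Fin 3 → Fin 3) i = a} F) ℂ).twist 1)) (permGL (finRotate 3) * diagonalGL (Fin 3) F ![Units.mk0 (ϖu : F) hϖ.ne_zero, 1, 1])⁻¹ : _ →ₗ[ℂ] _)) (φ (ι b))).toFun (permGL (ι a))) =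
      (Matrix.of fun a b : Fin 6 => ((((Representation.parabolicIndGL F (id : Fin 3 → Fin 3) ((Representation.trivial ℂ (Π a : Fin 3, GL {i : Fin 3 // (id : Fin 3 → Fin 3) i = a} F) ℂ).twist 1)) (permGL (finRotate 3) * diagonalGL (Fin 3) F ![Units.mk0 (ϖu : F) hϖ.ne_zero, 1, 1])⁻¹ : _ →ₗ[ℂ] _)) (φ (ι b))).toFun (permGL (ι a))) * (Matrix.of fun a b : Fin 6 => (Φ.toLinearMap (φ (ι b))).toFun (permGL (ι a))) := by
    ext a b
    rw [hmul Φ.toLinearMap _ hRfix a b, hmul _ Φ.toLinearMap hΦ' a b, Representation.IntertwiningMap.toLinearMap_apply,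
      Representation.IntertwiningMap.toLinearMap_apply, hcR]
  -- the three matrices are the literals
  have hT₁ : (Matrix.of fun a b : Fin 6 => (B₁ (φ (ι b))).toFun (permGL (ι a))) =
      !![0, 0, (Nat.card 𝓀[F] : ℂ), 0, 0, 0; 0, 0, 0, (Nat.card 𝓀[F] : ℂ), 0, 0; 1, 0, (Nat.card 𝓀[F] : ℂ) - 1, 0, 0, 0;
        0, 1, 0, (Nat.card 𝓀[F] : ℂ) - 1, 0, 0; 0, 0, 0, 0, 0, (Nat.card 𝓀[F] : ℂ); 0, 0, 0, 0, 1, (Nat.card 𝓀[F] : ℂ) - 1] := by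
    subst hι
    rw [← K2E3GL3IwahoriHeckeMatrices.table_T₁ (Nat.card 𝓀[F] : ℂ)]
    ext a b
    rw [Matrix.of_apply, Matrix.of_apply, hB₁v, K2E3GL3IwahoriHeckeMatrices.entry_hecke_swap 1 (i := 0) (j := 1) rfl φ hφ hφv]
  have hT₂ : (Matrix.of fun a b : Fin 6 => (B₂ (φ (ι b))).toFun (permGL (ι a))) =
      !![0, (Nat.card 𝓀[F] : ℂ), 0, 0, 0, 0; 1, (Nat.card 𝓀[F] : ℂ) - 1, 0, 0, 0, 0; 0, 0, 0, 0, (Nat.card 𝓀[F] : ℂ), 0;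
        0, 0, 0, 0, 0, (Nat.card 𝓀[F] : ℂ); 0, 0, 1, 0, (Nat.card 𝓀[F] : ℂ) - 1, 0; 0, 0, 0, 1, 0, (Nat.card 𝓀[F] : ℂ) - 1] := by
    subst hι
    rw [← K2E3GL3IwahoriHeckeMatrices.table_T₂ (Nat.card 𝓀[F] : ℂ)]
    ext a b
    rw [Matrix.of_apply, Matrix.of_apply, hB₂v, K2E3GL3IwahoriHeckeMatrices.entry_hecke_swap 1 (i := 1) (j := 2) rfl φ hφ hφv]
  have hP : (Matrix.of fun a b : Fin 6 => (((Representation.parabolicIndGL F (id : Fin 3 → Fin 3) ((Representation.trivial ℂ (Π a : Fin 3, GL {i : Fin 3 // (id : Fin 3 → Fin 3) i = a} F) ℂ).twist 1)) (permGL (finRotate 3) * diagonalGL (Fin 3) F ![Units.mk0 (ϖu : F) hϖ.ne_zero, 1, 1])⁻¹ : _ →ₗ[ℂ] _) (φ (ι b))).toFun (permGL (ι a))) =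
      !![0, 0, 0, 0, (Nat.card 𝓀[F] : ℂ), 0; 0, 0, 0, 0, 0, (Nat.card 𝓀[F] : ℂ); 0, 1, 0, 0, 0, 0; (Nat.card 𝓀[F] : ℂ)⁻¹, 0, 0, 0, 0, 0;
        0, 0, 0, 1, 0, 0; 0, 0, (Nat.card 𝓀[F] : ℂ)⁻¹, 0, 0, 0] := by
    subst hι
    rw [← K2E3GL3IwahoriHeckeMatrices.table_P (Nat.card 𝓀[F] : ℂ)]
    ext a b
    rw [Matrix.of_apply, Matrix.of_apply, K2E3GL3IwahoriHeckeMatrices.entry_R hϖ φ hφv, K2E3GL3IwahoriHeckeMatrices.normAbs_dInv_apply hϖ,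
      K2E3GL3IwahoriHeckeMatrices.normAbs_dInv_apply hϖ, cast_ite_mul_ite_inv]
  -- ★ IH-4: the matrix of `Φ` is scalar
  have hX := K2E3GL3IwahoriModuleIrreducible.eq_smul_one_of_commute hq0 hq1 rfl rfl rfl
    (hT₁ ▸ hX₁) (hT₂ ▸ hX₂) (hP ▸ hXP)
  refine ⟨(Matrix.of fun a b : Fin 6 => (Φ.toLinearMap (φ (ι b))).toFun (permGL (ι a))) 0 0, fun f hf => ?_⟩
  -- on the basis
  have hbasis : ∀ σ, Φ (φ σ) = (Matrix.of fun a b : Fin 6 => (Φ.toLinearMap (φ (ι b))).toFun (permGL (ι a))) 0 0 • φ σ := by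
    intro σ
    refine K2E3GL3IwahoriBruhat.eq_of_forall_toFun_permGL_eq 1 (hΦ σ) (Submodule.smul_mem _ _ (hφ σ)) fun τ => ?_
    have h := congrFun (congrFun hX (eι.symm τ)) (eι.symm σ)
    simp only [Matrix.smul_apply, Matrix.one_apply, eι.symm.injective.eq_iff, smul_eq_mul, Matrix.of_apply, hιe,
      Representation.IntertwiningMap.toLinearMap_apply] at h
    rw [Representation.SmoothInd.toFun_smul, Pi.smul_apply, hφv, smul_eq_mul, h]
    by_cases hτσ : τ = σ
    · rw [if_pos hτσ]; rfl
    · rw [if_neg hτσ, mul_zero, mul_zero]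
  -- on all of `I^{Iw}`
  rw [K2E3GLnIwahoriHeckeOperators.eq_sum_toFun_smul_basis 1 φ hφ hφv hf, map_sum, Finset.smul_sum]
  refine Finset.sum_congr rfl fun σ _ => ?_
  rw [map_smul, hbasis, smul_comm]

end Summit.HodgeConjecture.HodgeConjecture.Cruxes.H413.K2E3GL3IwahoriEndomorphismScalar

end
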